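import Literature.Computability.AlgebraicComplexity.BDI20EightRegularisationN
import Literature.Computability.AlgebraicComplexity.BDI20SemistandardHwvHardness
import Literature.Computability.Complexity.CodeFPStrings
import HarnessLib

/-!
# Bläser–Dörfler–Ikenmeyer 2020, Thm 30 (CCC 2021 Thm 8.9): the regularisation kit of the crossbar
# on codes, and the DISCHARGES `BDI2020_thm_8_9_holds`, `BDI2020_thm_8_9_eth_holds`

M. Bläser, J. Dörfler, C. Ikenmeyer, *On the complexity of evaluating highest weight vectors*,
arXiv:2002.11594 (= CCC 2021, LIPIcs 200:29), §8 Thm 30 with Lemmas 25, 26, 28, 29. Cell `val-lit`,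
seat x6 g8 (closer-owner of the §8 programme, lead-np RULINGS (124)–(126)); the last file of the
chain A (t20 `BDI20GridLikeLayeredGraphs`) · B (t20 `BDI20ColouringGadgets`) · C′ (x6
`BDI20CrossbarRelationalGrid`) · D (t20 `BDI20GadgetAssembly`, `BDI20EightRegularisationDegrees`,
`BDI20EightRegularisation`, `BDI20EightRegularisationN`) · E (x6 `BDI20SemistandardHwvTableau`) ·
glue/maps/closers (x6 `BDI20Thm30OfGridLike`, `BDI20Sec8MapsFP`, `BDI20SemistandardHwvHardness`).

CONTENTS.
* §1 `RegN.*FP` — t20's ℕ-mirrors of Lemma 29's construction (`RegN.pairListN … RegN.posN, RegN.multN,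
  RegN.card₂N` of `BDI20EightRegularisationN`) are polynomial-time ON CODES: `CodeFP` programs from
  `(N, pos, eqB, neB)` given on codes (`RegN.card₂FP`, ★ `RegN.posNFP`, ★ `RegN.multNFP`, with the
  intermediate `pairListFP … shareFP`, the four gadget tables `eqGadgetHMultFP …`, `multEqFP`,
  `multNeFP`, `placeFP`, the offset tables).
* §2 `Crossbar.noIsolated`, `Crossbar.eqB_neB_false` / `Crossbar.edgesSimple` — FILE D's two
  hypotheses hold for the crossbar; `Crossbar.card₂_le`: `≤ 585 (V+1)²` vertices.
* §3 ★ `Sec8.crossbarKit : Sec8.Regularisation` — the interface of `BDI20SemistandardHwvHardness`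
  INHABITED: `graph V adj := (crossbar V adj).regularise …` (t20's Lemma 29), `8`-regular,
  `3`-colourable iff the crossbar is relationally `3`-colourable, size `O(V²)`, and size / positions /
  multiplicities on codes by §1 through t20's bridges `card₂_crossbar`, `posOf_regularise_crossbar`,
  `multOf_regularise_crossbar`.
* §4 ★★ `BDI2020_thm_8_9_holds : BDI2020_thm_8_9` and ★★ `BDI2020_thm_8_9_eth_holds :
  BDI2020_thm_8_9_eth` — the discharges (`Sec8.Regularisation.thm_8_9_of_regularisation /
  …_eth_of_regularisation` at the kit).

No new named fact, no conjecture, no `instance`, no notation; `0` sorries. HONEST FRAMING: Thm 8.9 is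
an NP- and ETH-hardness statement about EVALUATING highest weight vectors (semistandard tableaux,
Waring-rank-5 point); ETH is a hypothesis of the second clause; nothing here bears on `VP ≠ VNP`,
which is NOT proved. DISCLOSED DEVIATION (programme-wide, `NOTE-x6g8-BDI20-sec8-LAYOUT.md`):
Lemma 28's printed layout (`H'_1–H'_3` + adjacent-swap sorting) is replaced by the crossbar; the
unprinted placement detail of Lemma 26 is t20's parity rule (registry B47).

## References
* [BlaserDorflerIkenmeyer2020] arXiv:2002.11594 Thm 30, Lemmas 25, 26, 28, 29 (= CCC 2021 Thm 8.9,
  Lemmas 8.4, 8.5, 8.7, 8.8).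
* [AroraBarak2009] CUP 2009, §1.3 (polynomial time; closure under bounded loops), Def. 2.7.
* [ImpagliazzoPaturiZaneJCSS2001] JCSS 63 (2001), §2.1.
-/

namespace Literature.Computability.AlgebraicComplexity

namespace BDI2020

/-! ## The mirrors on codes -/

namespace RegN

open Literature.Computability.Complexity CodeFP

section FP

variable {σ : Type} {eσ : σ → List Bool} {Nf Uf : σ → ℕ} {posf : σ → ℕ → ℕ × ℕ}
  {eqf nef : σ → ℕ → ℕ → Bool}
  (hN : CodeFP eσ natE Nf) (hU : CodeFP eσ unE Uf) (hNU : ∀ s, Nf s ≤ Uf s)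
  (hpos : CodeFP (pairE eσ natE) (pairE natE natE) (fun q => posf q.1 q.2))
  (heq : CodeFP (pairE eσ (pairE natE natE)) bitE (fun q => eqf q.1 q.2.1 q.2.2))
  (hne : CodeFP (pairE eσ (pairE natE natE)) bitE (fun q => nef q.1 q.2.1 q.2.2))

/-! ### Edge lists and the vertex count -/

include hN hU hNU in
/-- `pairListN` on codes. [cite: BlaserDorflerIkenmeyer2020, Lemma 26, proof (arXiv; = CCC 2021 Lemma 8.5)] [cite: AroraBarak2009, §1.3] -/
theorem pairListFP : CodeFP eσ (rawE (pairE natE natE)) (fun s => pairListN (Nf s)) := by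
  have hr := GridCols.rangeFP hN hU hNU
  have hitem : CodeFP (pairE (pairE eσ natE) natE) (pairE natE natE) (fun c => (c.1.2, c.2)) :=
    (fst _ _).snd'.pair (snd _ _)
  have hinner : CodeFP (pairE eσ natE) (rawE (pairE natE natE))
      (fun q => (List.range (Nf q.1)).map fun v => (q.2, v)) :=
    ((CodeFP.map hitem).comp ((CodeFP.id _).pair (hr.comp (fst _ _)))).congr fun _ => rfl
  have hall : CodeFP eσ (rawE (pairE natE natE))
      (fun s => (List.range (Nf s)).flatMap fun u => (List.range (Nf s)).map fun v => (u, v)) :=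
    ((flatten (pairE natE natE)).comp ((CodeFP.map hinner).comp ((CodeFP.id _).pair hr))).congr
      fun s => by simp only [id, List.flatMap_def]
  have hlt : CodeFP (pairE eσ (pairE natE natE)) bitE (fun q => decide (q.2.1 < q.2.2)) :=
    (natLt.comp ((snd _ _).fst'.pair (snd _ _).snd')).congr fun _ => rfl
  exact ((filter hlt).comp ((CodeFP.id _).pair hall)).congr fun _ => rfl

include hN hU hNU heq in
/-- `eqListN` on codes. [cite: BlaserDorflerIkenmeyer2020, Lemma 26, proof (arXiv; = CCC 2021 Lemma 8.5)] -/
theorem eqListFP : CodeFP eσ (rawE (pairE natE natE)) (fun s => eqListN (Nf s) (eqf s)) :=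
  ((filter heq).comp ((CodeFP.id _).pair (pairListFP hN hU hNU))).congr fun _ => rfl

include hN hU hNU hne in
/-- `neListN` on codes. [cite: BlaserDorflerIkenmeyer2020, Lemma 26, proof (arXiv; = CCC 2021 Lemma 8.5)] -/
theorem neListFP : CodeFP eσ (rawE (pairE natE natE)) (fun s => neListN (Nf s) (nef s)) :=
  ((filter hne).comp ((CodeFP.id _).pair (pairListFP hN hU hNU))).congr fun _ => rfl

include hN hU hNU heq hne in
/-- **`card₂N` on codes.** [cite: BlaserDorflerIkenmeyer2020, Lemma 29, proof (arXiv; = CCC 2021 Lemma 8.8)] -/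
theorem card₂FP : CodeFP eσ natE (fun s => card₂N (Nf s) (eqf s) (nef s)) := by
  have h1 := (natLength (pairE natE natE)).comp (eqListFP hN hU hNU heq)
  have h2 := (natLength (pairE natE natE)).comp (neListFP hN hU hNU hne)
  exact (natAdd.comp (hN.pair (natAdd.comp ((natMul.comp (h1.pair (const _ 5))).pair
    (natMul.comp (h2.pair (const _ 6))))))).congr fun _ => rfl

/-! ### Edge geometry: `loN`, `hiN`, `isHorN`, `parityN`, `placeN` (context `(s, e)`) -/

include hpos in
/-- The two coordinate sums of an edge on codes. [cite: BlaserDorflerIkenmeyer2020, Lemma 26, proof (arXiv; = CCC 2021 Lemma 8.5)] -/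
private theorem sumsFP :
    CodeFP (pairE eσ (pairE natE natE)) natE (fun q => (posf q.1 q.2.1).1 + (posf q.1 q.2.1).2) ∧
      CodeFP (pairE eσ (pairE natE natE)) natE (fun q => (posf q.1 q.2.2).1 + (posf q.1 q.2.2).2) := by
  have p1 : CodeFP (pairE eσ (pairE natE natE)) (pairE natE natE) (fun q => posf q.1 q.2.1) :=
    (hpos.comp ((fst _ _).pair (snd _ _).fst')).congr fun _ => rfl
  have p2 : CodeFP (pairE eσ (pairE natE natE)) (pairE natE natE) (fun q => posf q.1 q.2.2) :=
    (hpos.comp ((fst _ _).pair (snd _ _).snd')).congr fun _ => rfl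
  exact ⟨(natAdd.comp (p1.fst'.pair p1.snd')).congr fun _ => rfl,
    (natAdd.comp (p2.fst'.pair p2.snd')).congr fun _ => rfl⟩

include hpos in
/-- `loN` on codes. [cite: BlaserDorflerIkenmeyer2020, Lemma 26, proof (arXiv; = CCC 2021 Lemma 8.5)] -/
theorem loFP : CodeFP (pairE eσ (pairE natE natE)) natE (fun q => loN (posf q.1) q.2) := by
  obtain ⟨s1, s2⟩ := sumsFP (eσ := eσ) hpos
  exact ((natLe.comp (s1.pair s2)).ite (snd _ _).fst' (snd _ _).snd').congr fun q => by
    unfold loN; by_cases h : (posf q.1 q.2.1).1 + (posf q.1 q.2.1).2 ≤ (posf q.1 q.2.2).1 + (posf q.1 q.2.2).2 <;>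
      simp [h]

include hpos in
/-- `hiN` on codes. [cite: BlaserDorflerIkenmeyer2020, Lemma 26, proof (arXiv; = CCC 2021 Lemma 8.5)] -/
theorem hiFP : CodeFP (pairE eσ (pairE natE natE)) natE (fun q => hiN (posf q.1) q.2) := by
  obtain ⟨s1, s2⟩ := sumsFP (eσ := eσ) hpos
  exact ((natLe.comp (s1.pair s2)).ite (snd _ _).snd' (snd _ _).fst').congr fun q => by
    unfold hiN; by_cases h : (posf q.1 q.2.1).1 + (posf q.1 q.2.1).2 ≤ (posf q.1 q.2.2).1 + (posf q.1 q.2.2).2 <;>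
      simp [h]

include hpos in
/-- `isHorN` on codes. [cite: BlaserDorflerIkenmeyer2020, Lemma 26, proof (arXiv; = CCC 2021 Lemma 8.5)] -/
theorem isHorFP : CodeFP (pairE eσ (pairE natE natE)) bitE (fun q => isHorN (posf q.1) q.2) := by
  have p1 : CodeFP (pairE eσ (pairE natE natE)) (pairE natE natE) (fun q => posf q.1 q.2.1) :=
    (hpos.comp ((fst _ _).pair (snd _ _).fst')).congr fun _ => rfl
  have p2 : CodeFP (pairE eσ (pairE natE natE)) (pairE natE natE) (fun q => posf q.1 q.2.2) :=
    (hpos.comp ((fst _ _).pair (snd _ _).snd')).congr fun _ => rfl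
  exact (natEq.comp (p1.snd'.pair p2.snd')).congr fun _ => rfl

include hpos in
/-- The scaled position of the lower end, on codes. [cite: BlaserDorflerIkenmeyer2020, Lemma 26, proof (arXiv; = CCC 2021 Lemma 8.5)] -/
theorem baseFP : CodeFP (pairE eσ (pairE natE natE)) (pairE natE natE)
    (fun q => RelGridGraph.scalePos (posf q.1 (loN (posf q.1) q.2))) := by
  have hp : CodeFP (pairE eσ (pairE natE natE)) (pairE natE natE) (fun q => posf q.1 (loN (posf q.1) q.2)) :=
    (hpos.comp ((fst _ _).pair (loFP hpos))).congr fun _ => rfl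
  exact ((natAdd.comp ((natMul.comp ((const _ 4).pair hp.fst')).pair (const _ 2))).pair
    (natAdd.comp ((natMul.comp ((const _ 4).pair hp.snd')).pair (const _ 2)))).congr fun _ => rfl

include hpos in
/-- `parityN` on codes. [cite: BlaserDorflerIkenmeyer2020, Lemma 26, proof (arXiv; = CCC 2021 Lemma 8.5)] -/
theorem parityFP : CodeFP (pairE eσ (pairE natE natE)) natE (fun q => parityN (posf q.1) q.2) := by
  have hp : CodeFP (pairE eσ (pairE natE natE)) (pairE natE natE) (fun q => posf q.1 (loN (posf q.1) q.2)) :=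
    (hpos.comp ((fst _ _).pair (loFP hpos))).congr fun _ => rfl
  exact (natMod.comp ((natAdd.comp (hp.fst'.pair hp.snd')).pair (const _ 2))).congr fun _ => rfl

include hpos in
/-- **`placeN` on codes**, context `(s, (e, o))`. [cite: BlaserDorflerIkenmeyer2020, Lemma 26, proof (arXiv, TeX L1925–1926; = CCC 2021 Lemma 8.5)] -/
theorem placeFP : CodeFP (pairE eσ (pairE (pairE natE natE) (pairE natE natE))) (pairE natE natE)
    (fun q => placeN (posf q.1) q.2.1 q.2.2) := by
  let ctx : σ × ((ℕ × ℕ) × (ℕ × ℕ)) → List Bool := pairE eσ (pairE (pairE natE natE) (pairE natE natE))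
  have qe : CodeFP ctx (pairE eσ (pairE natE natE)) (fun q => (q.1, q.2.1)) := (fst _ _).pair (snd _ _).fst'
  have ho : CodeFP ctx (pairE natE natE) (fun q => q.2.2) := (snd _ _).snd'
  have hB : CodeFP ctx (pairE natE natE) (fun q => RelGridGraph.scalePos (posf q.1 (loN (posf q.1) q.2.1))) :=
    ((baseFP hpos).comp qe).congr fun _ => rfl
  have hh : CodeFP ctx bitE (fun q => isHorN (posf q.1) q.2.1) := ((isHorFP hpos).comp qe).congr fun _ => rfl
  have hp0 : CodeFP ctx bitE (fun q => decide (parityN (posf q.1) q.2.1 = 0)) :=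
    (natEq.comp (((parityFP hpos).comp qe).pair (const _ 0))).congr fun _ => rfl
  have xp := natAdd.comp (hB.fst'.pair ho.fst')
  have xm := natSub.comp (hB.fst'.pair ho.fst')
  have yp := natAdd.comp (hB.snd'.pair ho.snd')
  have ym := natSub.comp (hB.snd'.pair ho.snd')
  exact (hh.ite (hp0.ite (xp.pair yp) (xp.pair ym)) (hp0.ite (xm.pair yp) (xp.pair yp))).congr fun q => by
    unfold placeN
    by_cases h1 : isHorN (posf q.1) q.2.1 = true <;> by_cases h2 : parityN (posf q.1) q.2.1 = 0 <;> simp [h1, h2]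

/-! ### The offset tables -/

/-- A finitely supported table `ℕ → ℕ × ℕ` on codes. [cite: AroraBarak2009, §1.3] -/
private theorem tableFP (f : ℕ → ℕ × ℕ) (X Y : List ℕ) (hf : ∀ i, f i = (X.getD i 0, Y.getD i 0)) :
    CodeFP natE (pairE natE natE) f :=
  ((((rawGetD natE natE_zero).comp ((const _ X).pair (CodeFP.id natE))).pair
    ((rawGetD natE natE_zero).comp ((const _ Y).pair (CodeFP.id natE))))).congr fun i => by
    rw [hf]; rfl

/-- `offEqHN` on codes. [cite: BlaserDorflerIkenmeyer2020, Lemma 26, Fig. eqneqgadget (arXiv; = CCC 2021 Lemma 8.5)] -/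
theorem offEqHFP : CodeFP natE (pairE natE natE) offEqHN :=
  tableFP _ [0, 1, 1, 2, 3, 3, 4] [0, 0, 1, 0, 0, 1, 0] fun i => by
    unfold offEqHN
    by_cases h : i < 7
    · rw [dif_pos h]
      interval_cases i <;> rfl
    · rw [dif_neg h, List.getD_eq_default _ _ (by simp; omega), List.getD_eq_default _ _ (by simp; omega)]

/-- `offEqVN` on codes. [cite: BlaserDorflerIkenmeyer2020, Lemma 26, Fig. eqneqgadget (arXiv; = CCC 2021 Lemma 8.5)] -/
theorem offEqVFP : CodeFP natE (pairE natE natE) offEqVN :=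
  tableFP _ [0, 0, 1, 0, 0, 1, 0] [0, 1, 1, 2, 3, 3, 4] fun i => by
    unfold offEqVN
    by_cases h : i < 7
    · rw [dif_pos h]
      interval_cases i <;> rfl
    · rw [dif_neg h, List.getD_eq_default _ _ (by simp; omega), List.getD_eq_default _ _ (by simp; omega)]

/-- `offNeHN` on codes. [cite: BlaserDorflerIkenmeyer2020, Lemma 26, Fig. eqneqgadget (arXiv; = CCC 2021 Lemma 8.5)] -/
theorem offNeHFP : CodeFP natE (pairE natE natE) offNeHN :=
  tableFP _ [0, 1, 1, 2, 2, 3, 3, 4] [0, 0, 1, 0, 1, 0, 1, 0] fun i => by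
    unfold offNeHN
    by_cases h : i < 8
    · rw [dif_pos h]
      interval_cases i <;> rfl
    · rw [dif_neg h, List.getD_eq_default _ _ (by simp; omega), List.getD_eq_default _ _ (by simp; omega)]

/-- `offNeVN` on codes. [cite: BlaserDorflerIkenmeyer2020, Lemma 26, Fig. eqneqgadget (arXiv; = CCC 2021 Lemma 8.5)] -/
theorem offNeVFP : CodeFP natE (pairE natE natE) offNeVN :=
  tableFP _ [0, 0, 1, 0, 1, 0, 1, 0] [0, 1, 1, 2, 2, 3, 3, 4] fun i => by
    unfold offNeVN
    by_cases h : i < 8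
    · rw [dif_pos h]
      interval_cases i <;> rfl
    · rw [dif_neg h, List.getD_eq_default _ _ (by simp; omega), List.getD_eq_default _ _ (by simp; omega)]

/-! ### Counting: `memB`, `idxSum`, `incCountN`, `rankN`, `shareN` -/

/-- `memB` on codes, context `(e, v)`. [cite: BlaserDorflerIkenmeyer2020, Lemma 26, proof (arXiv; = CCC 2021 Lemma 8.5)] -/
theorem memBFP : CodeFP (pairE (pairE natE natE) natE) bitE (fun q => memB q.1 q.2) :=
  ((natEq.comp ((fst _ _).fst'.pair (snd _ _))).or (natEq.comp ((fst _ _).snd'.pair (snd _ _)))).congr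
    fun _ => by unfold memB; rw [Bool.eq_iff_iff]; simp

/-- `idxSum` on codes (the range below a unary budget). [cite: AroraBarak2009, §1.3] -/
theorem idxSumFP {τ : Type} {eτ : τ → List Bool} {nf Bf : τ → ℕ} {f : τ → ℕ → Bool}
    (hn : CodeFP eτ natE nf) (hB : CodeFP eτ unE Bf) (hnB : ∀ t, nf t ≤ Bf t)
    (hf : CodeFP (pairE eτ natE) bitE (fun q => f q.1 q.2)) :
    CodeFP eτ natE (fun t => idxSum (nf t) (f t)) := by
  have hr := GridCols.rangeFP hn hB hnB
  have hitem : CodeFP (pairE eτ natE) natE (fun q => if f q.1 q.2 = true then 1 else 0) :=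
    (hf.ite (const _ 1) (const _ 0)).congr fun _ => rfl
  exact (natSum.comp ((CodeFP.map hitem).comp ((CodeFP.id _).pair hr))).congr fun _ => rfl

/-- Reading a pair list at an index (default `(0,0)`), on codes, context `(L, j)`. [cite: AroraBarak2009, §1.3] -/
theorem getPairFP : CodeFP (pairE (rawE (pairE natE natE)) natE) (pairE natE natE) (fun q => q.1.getD q.2 (0, 0)) := by
  have h1 : CodeFP (pairE (rawE (pairE natE natE)) natE) natE (fun q => (q.1.map Prod.fst).getD q.2 0) :=
    ((rawGetD natE natE_zero).comp (((map₀ (fst natE natE)).comp (fst _ _)).pair (snd _ _))).congr fun _ => rfl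
  have h2 : CodeFP (pairE (rawE (pairE natE natE)) natE) natE (fun q => (q.1.map Prod.snd).getD q.2 0) :=
    ((rawGetD natE natE_zero).comp (((map₀ (snd natE natE)).comp (fst _ _)).pair (snd _ _))).congr fun _ => rfl
  exact (h1.pair h2).congr fun q => by
    rw [show (0 : ℕ) = Prod.fst ((0 : ℕ), (0 : ℕ)) from rfl, List.getD_map,
      show (Prod.fst ((0 : ℕ), (0 : ℕ))) = Prod.snd ((0 : ℕ), (0 : ℕ)) from rfl, List.getD_map]

/-- The counting functional `idxSum |L| (fun j => memB (L.getD j (0,0)) v && extra j)` on codes, for a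
list `L`, a vertex `v` and an extra bit given on a context. [cite: BlaserDorflerIkenmeyer2020, Lemma 26, proof (arXiv; = CCC 2021 Lemma 8.5)] [cite: AroraBarak2009, §1.3] -/
theorem countMemFP {τ : Type} {eτ : τ → List Bool} {Lf : τ → List (ℕ × ℕ)} {vf : τ → ℕ} {xf : τ → ℕ → Bool}
    (hL : CodeFP eτ (rawE (pairE natE natE)) Lf) (hv : CodeFP eτ natE vf)
    (hx : CodeFP (pairE eτ natE) bitE (fun q => xf q.1 q.2)) :
    CodeFP eτ natE (fun t => idxSum (Lf t).length (fun j => memB ((Lf t).getD j (0, 0)) (vf t) && xf t j)) := by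
  have hget : CodeFP (pairE eτ natE) (pairE natE natE) (fun q => (Lf q.1).getD q.2 (0, 0)) :=
    (getPairFP.comp ((hL.comp (fst _ _)).pair (snd _ _))).congr fun _ => rfl
  have hm : CodeFP (pairE eτ natE) bitE (fun q => memB ((Lf q.1).getD q.2 (0, 0)) (vf q.1)) :=
    (memBFP.comp (hget.pair (hv.comp (fst _ _)))).congr fun _ => rfl
  exact idxSumFP ((natLength _).comp hL) ((ulength _).comp hL) (fun _ => le_rfl) (hm.and hx)

include hN hU hNU heq hne in
/-- **`incCountN` on codes**, context `(s, v)`. [cite: BlaserDorflerIkenmeyer2020, Lemma 26, proof (arXiv; = CCC 2021 Lemma 8.5)] -/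
theorem incCountFP : CodeFP (pairE eσ natE) natE (fun q => incCountN (Nf q.1) (eqf q.1) (nef q.1) q.2) := by
  have hE := (eqListFP hN hU hNU heq).comp (fst eσ natE)
  have hNe := (neListFP hN hU hNU hne).comp (fst eσ natE)
  have h1 := countMemFP (xf := fun _ _ => true) hE (snd _ _) (const _ true)
  have h2 := countMemFP (xf := fun _ _ => true) hNe (snd _ _) (const _ true)
  exact (natAdd.comp (h1.pair h2)).congr fun q => by simp only [incCountN, Bool.and_true]

/-- Context of the allocation: `(s, (b, (j, v)))`. [cite: AroraBarak2009, §1.3] -/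
abbrev actx (eσ : σ → List Bool) : σ × (Bool × (ℕ × ℕ)) → List Bool := pairE eσ (pairE bitE (pairE natE natE))

include hN hU hNU heq hne in
/-- **`rankN` on codes**, context `(s, (b, (j, v)))`. [cite: BlaserDorflerIkenmeyer2020, Lemma 26, proof (arXiv; = CCC 2021 Lemma 8.5)] -/
theorem rankFP : CodeFP (actx eσ) natE (fun q => rankN (Nf q.1) (eqf q.1) (nef q.1) q.2.1 q.2.2.1 q.2.2.2) := by
  have hE := (eqListFP hN hU hNU heq).comp (fst eσ (pairE bitE (pairE natE natE)))
  have hNe := (neListFP hN hU hNU hne).comp (fst eσ (pairE bitE (pairE natE natE)))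
  have hv : CodeFP (actx eσ) natE (fun q => q.2.2.2) := (snd _ _).snd'.snd'
  have hj : CodeFP (actx eσ) natE (fun q => q.2.2.1) := (snd _ _).snd'.fst'
  have hb : CodeFP (actx eσ) bitE (fun q => q.2.1) := (snd _ _).fst'
  have hlt : CodeFP (pairE (actx eσ) natE) bitE (fun c => decide (c.2 < c.1.2.2.1)) :=
    (natLt.comp ((snd _ _).pair (hj.comp (fst _ _)))).congr fun _ => rfl
  have h1 := countMemFP (xf := fun t j => decide (j < t.2.2.1)) hE hv hlt
  have h2 := countMemFP (xf := fun _ _ => true) hE hv (const _ true)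
  have h3 := countMemFP (xf := fun t j => decide (j < t.2.2.1)) hNe hv hlt
  exact (hb.ite h1 (natAdd.comp (h2.pair h3))).congr fun q => by
    simp only [rankN, Bool.and_true]

/-- `shareTable` on codes. [cite: BlaserDorflerIkenmeyer2020, Lemma 26, proof and Fig. eqgadgetmult (arXiv; = CCC 2021 Lemma 8.5)] -/
theorem shareTableFP : CodeFP (pairE natE natE) natE (fun p => RelGridGraph.shareTable p.1 p.2) := by
  have hd : CodeFP (pairE natE natE) natE (fun p => p.1) := fst _ _
  have hr : CodeFP (pairE natE natE) natE (fun p => p.2) := snd _ _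
  have c1 : CodeFP (pairE natE natE) bitE (fun p => decide (p.1 ≤ 1)) := (natLe.comp (hd.pair (const _ 1))).congr fun _ => rfl
  have c2 : CodeFP (pairE natE natE) bitE (fun p => decide (p.1 = 2)) := (natEq.comp (hd.pair (const _ 2))).congr fun _ => rfl
  have c3 : CodeFP (pairE natE natE) bitE (fun p => decide (p.1 = 3)) := (natEq.comp (hd.pair (const _ 3))).congr fun _ => rfl
  have c4 : CodeFP (pairE natE natE) bitE (fun p => decide (p.2 = 0)) := (natEq.comp (hr.pair (const _ 0))).congr fun _ => rfl
  exact (c1.ite (const _ 4) (c2.ite (const _ 2) (c3.ite (c4.ite (const _ 2) (const _ 1)) (const _ 1)))).congr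
    fun p => by
      unfold RelGridGraph.shareTable
      by_cases h1 : p.1 ≤ 1 <;> by_cases h2 : p.1 = 2 <;> by_cases h3 : p.1 = 3 <;> by_cases h4 : p.2 = 0 <;>
        simp [h1, h2, h3, h4]

include hN hU hNU heq hne in
/-- **`shareN` on codes**, context `(s, (b, (j, v)))`. [cite: BlaserDorflerIkenmeyer2020, Lemma 26, proof (arXiv; = CCC 2021 Lemma 8.5)] -/
theorem shareFP : CodeFP (actx eσ) natE (fun q => shareN (Nf q.1) (eqf q.1) (nef q.1) q.2.1 q.2.2.1 q.2.2.2) := by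
  have hc : CodeFP (actx eσ) natE (fun q => incCountN (Nf q.1) (eqf q.1) (nef q.1) q.2.2.2) :=
    ((incCountFP hN hU hNU heq hne).comp ((fst _ _).pair (snd _ _).snd'.snd')).congr fun _ => rfl
  exact (shareTableFP.comp (hc.pair (rankFP hN hU hNU heq hne))).congr fun _ => rfl

/-! ### The gadget multiplicity tables -/

/-- Context of a table read: `((a, b), (u, v))`. [cite: AroraBarak2009, §1.3] -/
abbrev tctx : (ℕ × ℕ) × (ℕ × ℕ) → List Bool := pairE (pairE natE natE) (pairE natE natE)

/-- Code of a weighted edge `(x, y, m)`. [cite: AroraBarak2009, §1.3] -/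
abbrev tripE : ℕ × ℕ × ℕ → List Bool := pairE natE (pairE natE natE)

/-- `multOfN` on codes, context `(L, (u, v))`. [cite: BlaserDorflerIkenmeyer2020, Lemma 26, proof (arXiv; = CCC 2021 Lemma 8.5)] [cite: AroraBarak2009, §1.3] -/
theorem multOfFP : CodeFP (pairE (rawE tripE) (pairE natE natE)) natE (fun q => multOfN q.1 q.2.1 q.2.2) := by
  let ictx : (ℕ × ℕ) × (ℕ × ℕ × ℕ) → List Bool := pairE (pairE natE natE) tripE
  have hu : CodeFP ictx natE (fun c => c.1.1) := (fst _ _).fst'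
  have hv : CodeFP ictx natE (fun c => c.1.2) := (fst _ _).snd'
  have t1 : CodeFP ictx natE (fun c => c.2.1) := (snd _ _).fst'
  have t2 : CodeFP ictx natE (fun c => c.2.2.1) := (snd _ _).snd'.fst'
  have t3 : CodeFP ictx natE (fun c => c.2.2.2) := (snd _ _).snd'.snd'
  have hc : CodeFP ictx bitE (fun c => (decide (c.2.1 = c.1.1) && decide (c.2.2.1 = c.1.2)) ||
      (decide (c.2.1 = c.1.2) && decide (c.2.2.1 = c.1.1))) :=
    (((natEq.comp (t1.pair hu)).and (natEq.comp (t2.pair hv))).or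
      ((natEq.comp (t1.pair hv)).and (natEq.comp (t2.pair hu)))).congr fun _ => rfl
  have hitem : CodeFP ictx natE (fun c =>
      if (c.2.1 = c.1.1 ∧ c.2.2.1 = c.1.2) ∨ (c.2.1 = c.1.2 ∧ c.2.2.1 = c.1.1) then c.2.2.2 else 0) :=
    (hc.ite t3 (const _ 0)).congr fun c => by
      by_cases h : (c.2.1 = c.1.1 ∧ c.2.2.1 = c.1.2) ∨ (c.2.1 = c.1.2 ∧ c.2.2.1 = c.1.1) <;> simp [h]
  exact (natSum.comp ((CodeFP.map hitem).comp ((snd _ _).pair (fst _ _)))).congr fun _ => rfl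

/-- Prepending a weighted edge `(x, y, z)` with constant ends, on codes. [cite: AroraBarak2009, §1.3] -/
private theorem consTripFP (x y : ℕ) {z : (ℕ × ℕ) × (ℕ × ℕ) → ℕ} {r : (ℕ × ℕ) × (ℕ × ℕ) → List (ℕ × ℕ × ℕ)}
    (hz : CodeFP tctx natE z) (hr : CodeFP tctx (rawE tripE) r) :
    CodeFP tctx (rawE tripE) (fun q => (x, y, z q) :: r q) :=
  ((rawCons tripE).comp ((((const _ x).pair ((const _ y).pair hz))).pair hr)).congr fun _ => rfl

/-- The parameters `a`, `b`, `6 - a`, `6 - b` and constants on the table context. [cite: AroraBarak2009, §1.3] -/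
private theorem paramsFP :
    CodeFP tctx natE (fun q => q.1.1) ∧ CodeFP tctx natE (fun q => q.1.2) ∧
      CodeFP tctx natE (fun q => 6 - q.1.1) ∧ CodeFP tctx natE (fun q => 6 - q.1.2) :=
  ⟨(fst _ _).fst', (fst _ _).snd', (natSub.comp ((const _ 6).pair (fst _ _).fst')).congr fun _ => rfl,
    (natSub.comp ((const _ 6).pair (fst _ _).snd')).congr fun _ => rfl⟩

/-- `eqGadgetHMultN` on codes. [cite: BlaserDorflerIkenmeyer2020, Lemma 26, Fig. eqgadgetmult (arXiv; = CCC 2021 Lemma 8.5)] -/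
theorem eqGadgetHMultFP : CodeFP tctx natE (fun q => eqGadgetHMultN q.1.1 q.1.2 q.2.1 q.2.2) := by
  obtain ⟨ha, hb, ha', hb'⟩ := paramsFP
  have h2 : CodeFP tctx natE (fun _ => 2) := const _ 2
  have hL := consTripFP 0 2 ha (consTripFP 0 1 ha (consTripFP 1 2 ha' (consTripFP 2 3 h2 (consTripFP 1 3 h2
    (consTripFP 3 5 h2 (consTripFP 3 4 h2 (consTripFP 4 5 hb' (consTripFP 5 6 hb (consTripFP 4 6 hb
    (const tctx ([] : List (ℕ × ℕ × ℕ))))))))))))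
  exact (multOfFP.comp (hL.pair (snd _ _))).congr fun _ => rfl

/-- `eqGadgetVMultN` on codes. [cite: BlaserDorflerIkenmeyer2020, Lemma 26, Fig. eqgadgetmult (arXiv; = CCC 2021 Lemma 8.5)] -/
theorem eqGadgetVMultFP : CodeFP tctx natE (fun q => eqGadgetVMultN q.1.1 q.1.2 q.2.1 q.2.2) := by
  obtain ⟨ha, hb, ha', hb'⟩ := paramsFP
  have h2 : CodeFP tctx natE (fun _ => 2) := const _ 2
  have hL := consTripFP 0 1 hb (consTripFP 0 2 hb (consTripFP 1 2 hb' (consTripFP 1 3 h2 (consTripFP 2 3 h2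
    (consTripFP 3 4 h2 (consTripFP 3 5 h2 (consTripFP 4 5 ha' (consTripFP 4 6 ha (consTripFP 5 6 ha
    (const tctx ([] : List (ℕ × ℕ × ℕ))))))))))))
  exact (multOfFP.comp (hL.pair (snd _ _))).congr fun _ => rfl

/-- `neGadgetHMultN` on codes. [cite: BlaserDorflerIkenmeyer2020, Lemma 26, Fig. eqgadgetmult (arXiv; = CCC 2021 Lemma 8.5)] -/
theorem neGadgetHMultFP : CodeFP tctx natE (fun q => neGadgetHMultN q.1.1 q.1.2 q.2.1 q.2.2) := by
  obtain ⟨ha, hb, ha', hb'⟩ := paramsFP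
  have h2 : CodeFP tctx natE (fun _ => 2) := const _ 2
  have h4 : CodeFP tctx natE (fun _ => 4) := const _ 4
  have hL := consTripFP 0 2 ha (consTripFP 0 1 ha (consTripFP 1 2 ha' (consTripFP 2 3 h2 (consTripFP 1 3 h2
    (consTripFP 3 4 h4 (consTripFP 4 6 h2 (consTripFP 4 5 h2 (consTripFP 5 6 hb' (consTripFP 6 7 hb
    (consTripFP 5 7 hb (const tctx ([] : List (ℕ × ℕ × ℕ)))))))))))))
  exact (multOfFP.comp (hL.pair (snd _ _))).congr fun _ => rfl

/-- `neGadgetVMultN` on codes. [cite: BlaserDorflerIkenmeyer2020, Lemma 26, Fig. eqgadgetmult (arXiv; = CCC 2021 Lemma 8.5)] -/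
theorem neGadgetVMultFP : CodeFP tctx natE (fun q => neGadgetVMultN q.1.1 q.1.2 q.2.1 q.2.2) := by
  obtain ⟨ha, hb, ha', hb'⟩ := paramsFP
  have h2 : CodeFP tctx natE (fun _ => 2) := const _ 2
  have h4 : CodeFP tctx natE (fun _ => 4) := const _ 4
  have hL := consTripFP 0 1 hb (consTripFP 0 2 hb (consTripFP 1 2 hb' (consTripFP 1 3 h2 (consTripFP 2 3 h2
    (consTripFP 3 4 h4 (consTripFP 4 5 h2 (consTripFP 4 6 h2 (consTripFP 5 6 ha' (consTripFP 6 7 ha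
    (consTripFP 5 7 ha (const tctx ([] : List (ℕ × ℕ × ℕ)))))))))))))
  exact (multOfFP.comp (hL.pair (snd _ _))).congr fun _ => rfl

/-! ### Local multiplicity tables of a gadget: `multEqN`, `multNeN` (context `(s, (j, (a, b)))`) -/

/-- Context `(s, (j, (a, b)))`. [cite: AroraBarak2009, §1.3] -/
abbrev mctx (eσ : σ → List Bool) : σ × (ℕ × (ℕ × ℕ)) → List Bool := pairE eσ (pairE natE (pairE natE natE))

include hN hU hNU hpos heq hne in
/-- **`multEqN` on codes.** [cite: BlaserDorflerIkenmeyer2020, Lemma 26, proof (arXiv, TeX L1927–1932; = CCC 2021 Lemma 8.5)] -/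
theorem multEqFP : CodeFP (mctx eσ) natE
    (fun q => multEqN (Nf q.1) (posf q.1) (eqf q.1) (nef q.1) q.2.1 q.2.2.1 q.2.2.2) := by
  have hs : CodeFP (mctx eσ) eσ (fun q => q.1) := fst _ _
  have hj : CodeFP (mctx eσ) natE (fun q => q.2.1) := (snd _ _).fst'
  have hab : CodeFP (mctx eσ) (pairE natE natE) (fun q => q.2.2) := (snd _ _).snd'
  have he : CodeFP (mctx eσ) (pairE natE natE) (fun q => (eqListN (Nf q.1) (eqf q.1)).getD q.2.1 (0, 0)) :=
    (getPairFP.comp (((eqListFP hN hU hNU heq).comp hs).pair hj)).congr fun _ => rfl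
  have hh : CodeFP (mctx eσ) bitE (fun q => isHorN (posf q.1) ((eqListN (Nf q.1) (eqf q.1)).getD q.2.1 (0, 0))) :=
    ((isHorFP hpos).comp (hs.pair he)).congr fun _ => rfl
  have hlo : CodeFP (mctx eσ) natE (fun q => loN (posf q.1) ((eqListN (Nf q.1) (eqf q.1)).getD q.2.1 (0, 0))) :=
    ((loFP hpos).comp (hs.pair he)).congr fun _ => rfl
  have hhi : CodeFP (mctx eσ) natE (fun q => hiN (posf q.1) ((eqListN (Nf q.1) (eqf q.1)).getD q.2.1 (0, 0))) :=
    ((hiFP hpos).comp (hs.pair he)).congr fun _ => rfl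
  have hsh := shareFP hN hU hNU heq hne
  have sLo : CodeFP (mctx eσ) natE (fun q => shareN (Nf q.1) (eqf q.1) (nef q.1) true q.2.1
      (loN (posf q.1) ((eqListN (Nf q.1) (eqf q.1)).getD q.2.1 (0, 0)))) :=
    (hsh.comp (hs.pair ((const _ true).pair (hj.pair hlo)))).congr fun _ => rfl
  have sHi : CodeFP (mctx eσ) natE (fun q => shareN (Nf q.1) (eqf q.1) (nef q.1) true q.2.1
      (hiN (posf q.1) ((eqListN (Nf q.1) (eqf q.1)).getD q.2.1 (0, 0)))) :=
    (hsh.comp (hs.pair ((const _ true).pair (hj.pair hhi)))).congr fun _ => rfl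
  have vH := eqGadgetHMultFP.comp ((sLo.pair sHi).pair hab)
  have vV := eqGadgetVMultFP.comp ((sHi.pair sLo).pair hab)
  exact (hh.ite vH vV).congr fun q => by
    unfold multEqN
    dsimp only

include hN hU hNU hpos heq hne in
/-- **`multNeN` on codes.** [cite: BlaserDorflerIkenmeyer2020, Lemma 26, proof (arXiv, TeX L1927–1932; = CCC 2021 Lemma 8.5)] -/
theorem multNeFP : CodeFP (mctx eσ) natE
    (fun q => multNeN (Nf q.1) (posf q.1) (eqf q.1) (nef q.1) q.2.1 q.2.2.1 q.2.2.2) := by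
  have hs : CodeFP (mctx eσ) eσ (fun q => q.1) := fst _ _
  have hj : CodeFP (mctx eσ) natE (fun q => q.2.1) := (snd _ _).fst'
  have hab : CodeFP (mctx eσ) (pairE natE natE) (fun q => q.2.2) := (snd _ _).snd'
  have he : CodeFP (mctx eσ) (pairE natE natE) (fun q => (neListN (Nf q.1) (nef q.1)).getD q.2.1 (0, 0)) :=
    (getPairFP.comp (((neListFP hN hU hNU hne).comp hs).pair hj)).congr fun _ => rfl
  have hh : CodeFP (mctx eσ) bitE (fun q => isHorN (posf q.1) ((neListN (Nf q.1) (nef q.1)).getD q.2.1 (0, 0))) :=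
    ((isHorFP hpos).comp (hs.pair he)).congr fun _ => rfl
  have hlo : CodeFP (mctx eσ) natE (fun q => loN (posf q.1) ((neListN (Nf q.1) (nef q.1)).getD q.2.1 (0, 0))) :=
    ((loFP hpos).comp (hs.pair he)).congr fun _ => rfl
  have hhi : CodeFP (mctx eσ) natE (fun q => hiN (posf q.1) ((neListN (Nf q.1) (nef q.1)).getD q.2.1 (0, 0))) :=
    ((hiFP hpos).comp (hs.pair he)).congr fun _ => rfl
  have hsh := shareFP hN hU hNU heq hne
  have sLo : CodeFP (mctx eσ) natE (fun q => shareN (Nf q.1) (eqf q.1) (nef q.1) false q.2.1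
      (loN (posf q.1) ((neListN (Nf q.1) (nef q.1)).getD q.2.1 (0, 0)))) :=
    (hsh.comp (hs.pair ((const _ false).pair (hj.pair hlo)))).congr fun _ => rfl
  have sHi : CodeFP (mctx eσ) natE (fun q => shareN (Nf q.1) (eqf q.1) (nef q.1) false q.2.1
      (hiN (posf q.1) ((neListN (Nf q.1) (nef q.1)).getD q.2.1 (0, 0)))) :=
    (hsh.comp (hs.pair ((const _ false).pair (hj.pair hhi)))).congr fun _ => rfl
  have vH := neGadgetHMultFP.comp ((sLo.pair sHi).pair hab)
  have vV := neGadgetVMultFP.comp ((sHi.pair sLo).pair hab)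
  exact (hh.ite vH vV).congr fun q => by
    unfold multNeN
    dsimp only


/-! ### The positions `posN` on codes (context `(s, i)`) -/

include hN hU hNU hpos heq hne in
/-- **`RegN.posN` on codes.** [cite: BlaserDorflerIkenmeyer2020, Lemma 26/29, proof (arXiv, TeX L1925–1926, L2278–2283; = CCC 2021 Lemmas 8.5/8.8)] [cite: AroraBarak2009, §1.3] -/
theorem posNFP : CodeFP (pairE eσ natE) (pairE natE natE)
    (fun q => posN (Nf q.1) (posf q.1) (eqf q.1) (nef q.1) q.2) := by
  let pctx : σ × ℕ → List Bool := pairE eσ natE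
  have hs : CodeFP pctx eσ (fun q => q.1) := fst _ _
  have hi : CodeFP pctx natE (fun q => q.2) := snd _ _
  have hNq : CodeFP pctx natE (fun q => Nf q.1) := (hN.comp hs).congr fun _ => rfl
  have hEq : CodeFP pctx (rawE (pairE natE natE)) (fun q => eqListN (Nf q.1) (eqf q.1)) :=
    ((eqListFP hN hU hNU heq).comp hs).congr fun _ => rfl
  have hNe : CodeFP pctx (rawE (pairE natE natE)) (fun q => neListN (Nf q.1) (nef q.1)) :=
    ((neListFP hN hU hNU hne).comp hs).congr fun _ => rfl
  have hC : CodeFP pctx natE (fun q => card₂N (Nf q.1) (eqf q.1) (nef q.1)) :=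
    ((card₂FP hN hU hNU heq hne).comp hs).congr fun _ => rfl
  have hL5 : CodeFP pctx natE (fun q => (eqListN (Nf q.1) (eqf q.1)).length * 5) :=
    (natMul.comp (((natLength _).comp hEq).pair (const _ 5))).congr fun _ => rfl
  have hiN : CodeFP pctx natE (fun q => q.2 - Nf q.1) := (natSub.comp (hi.pair hNq)).congr fun _ => rfl
  -- conditions
  have c1 : CodeFP pctx bitE (fun q => decide (q.2 < card₂N (Nf q.1) (eqf q.1) (nef q.1))) :=
    (natLt.comp (hi.pair hC)).congr fun _ => rfl
  have c2 : CodeFP pctx bitE (fun q => decide (q.2 < Nf q.1)) := (natLt.comp (hi.pair hNq)).congr fun _ => rfl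
  have c3 : CodeFP pctx bitE (fun q => decide (q.2 - Nf q.1 < (eqListN (Nf q.1) (eqf q.1)).length * 5)) :=
    (natLt.comp (hiN.pair hL5)).congr fun _ => rfl
  -- port value
  have hp : CodeFP pctx (pairE natE natE) (fun q => posf q.1 q.2) := hpos
  have v1 : CodeFP pctx (pairE natE natE) (fun q => RelGridGraph.scalePos (posf q.1 q.2)) :=
    ((natAdd.comp ((natMul.comp ((const _ 4).pair hp.fst')).pair (const _ 2))).pair
      (natAdd.comp ((natMul.comp ((const _ 4).pair hp.snd')).pair (const _ 2)))).congr fun _ => rfl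
  -- equality-gadget inner vertex
  have e2 : CodeFP pctx (pairE natE natE) (fun q => (eqListN (Nf q.1) (eqf q.1)).getD ((q.2 - Nf q.1) / 5) (0, 0)) :=
    (getPairFP.comp (hEq.pair (natDiv.comp (hiN.pair (const _ 5))))).congr fun _ => rfl
  have t2 : CodeFP pctx natE (fun q => (q.2 - Nf q.1) % 5 + 1) :=
    (natAdd.comp ((natMod.comp (hiN.pair (const _ 5))).pair (const _ 1))).congr fun _ => rfl
  have h2 : CodeFP pctx bitE (fun q => isHorN (posf q.1) ((eqListN (Nf q.1) (eqf q.1)).getD ((q.2 - Nf q.1) / 5) (0, 0))) :=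
    ((isHorFP hpos).comp (hs.pair e2)).congr fun _ => rfl
  have o2 := h2.ite (offEqHFP.comp t2) (offEqVFP.comp t2)
  have v2 := (placeFP hpos).comp (hs.pair (e2.pair o2))
  -- inequality-gadget inner vertex
  have hk : CodeFP pctx natE (fun q => q.2 - Nf q.1 - (eqListN (Nf q.1) (eqf q.1)).length * 5) :=
    (natSub.comp (hiN.pair hL5)).congr fun _ => rfl
  have e3 : CodeFP pctx (pairE natE natE) (fun q => (neListN (Nf q.1) (nef q.1)).getD
      ((q.2 - Nf q.1 - (eqListN (Nf q.1) (eqf q.1)).length * 5) / 6) (0, 0)) :=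
    (getPairFP.comp (hNe.pair (natDiv.comp (hk.pair (const _ 6))))).congr fun _ => rfl
  have t3 : CodeFP pctx natE (fun q => (q.2 - Nf q.1 - (eqListN (Nf q.1) (eqf q.1)).length * 5) % 6 + 1) :=
    (natAdd.comp ((natMod.comp (hk.pair (const _ 6))).pair (const _ 1))).congr fun _ => rfl
  have h3 : CodeFP pctx bitE (fun q => isHorN (posf q.1) ((neListN (Nf q.1) (nef q.1)).getD
      ((q.2 - Nf q.1 - (eqListN (Nf q.1) (eqf q.1)).length * 5) / 6) (0, 0))) :=
    ((isHorFP hpos).comp (hs.pair e3)).congr fun _ => rfl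
  have o3 := h3.ite (offNeHFP.comp t3) (offNeVFP.comp t3)
  have v3 := (placeFP hpos).comp (hs.pair (e3.pair o3))
  exact (c1.ite (c2.ite v1 (c3.ite v2 v3)) (const _ ((0 : ℕ), (0 : ℕ)))).congr fun q => by
    unfold posN
    simp only [decide_eq_true_eq]

/-! ### The multiplicities `multN` on codes (context `(s, (i, i'))`) -/

include hN hU hNU hpos heq hne in
/-- **`RegN.multN` on codes.** [cite: BlaserDorflerIkenmeyer2020, Lemma 26/29, proof (arXiv, TeX L1927–1932, L2278–2283; = CCC 2021 Lemmas 8.5/8.8)] [cite: AroraBarak2009, §1.3] -/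
theorem multNFP : CodeFP (pairE eσ (pairE natE natE)) natE
    (fun q => multN (Nf q.1) (posf q.1) (eqf q.1) (nef q.1) q.2.1 q.2.2) := by
  let qctx : σ × (ℕ × ℕ) → List Bool := pairE eσ (pairE natE natE)
  have hs : CodeFP qctx eσ (fun q => q.1) := fst _ _
  have hi : CodeFP qctx natE (fun q => q.2.1) := (snd _ _).fst'
  have hi' : CodeFP qctx natE (fun q => q.2.2) := (snd _ _).snd'
  have hNq : CodeFP qctx natE (fun q => Nf q.1) := (hN.comp hs).congr fun _ => rfl
  have hEq : CodeFP qctx (rawE (pairE natE natE)) (fun q => eqListN (Nf q.1) (eqf q.1)) :=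
    ((eqListFP hN hU hNU heq).comp hs).congr fun _ => rfl
  have hNe : CodeFP qctx (rawE (pairE natE natE)) (fun q => neListN (Nf q.1) (nef q.1)) :=
    ((neListFP hN hU hNU hne).comp hs).congr fun _ => rfl
  have hC : CodeFP qctx natE (fun q => card₂N (Nf q.1) (eqf q.1) (nef q.1)) :=
    ((card₂FP hN hU hNU heq hne).comp hs).congr fun _ => rfl
  have hL5 : CodeFP qctx natE (fun q => (eqListN (Nf q.1) (eqf q.1)).length * 5) :=
    (natMul.comp (((natLength _).comp hEq).pair (const _ 5))).congr fun _ => rfl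
  have hME := multEqFP hN hU hNU hpos heq hne
  have hMN := multNeFP hN hU hNU hpos heq hne
  have hlo : ∀ {ef : σ × (ℕ × ℕ) → ℕ × ℕ}, CodeFP qctx (pairE natE natE) ef →
      CodeFP qctx natE (fun q => loN (posf q.1) (ef q)) := fun he => ((loFP hpos).comp (hs.pair he)).congr fun _ => rfl
  have hhi : ∀ {ef : σ × (ℕ × ℕ) → ℕ × ℕ}, CodeFP qctx (pairE natE natE) ef →
      CodeFP qctx natE (fun q => hiN (posf q.1) (ef q)) := fun he => ((hiFP hpos).comp (hs.pair he)).congr fun _ => rfl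
  have hmE : ∀ {jf af bf : σ × (ℕ × ℕ) → ℕ}, CodeFP qctx natE jf → CodeFP qctx natE af → CodeFP qctx natE bf →
      CodeFP qctx natE (fun q => multEqN (Nf q.1) (posf q.1) (eqf q.1) (nef q.1) (jf q) (af q) (bf q)) :=
    fun hj ha hb => (hME.comp (hs.pair (hj.pair (ha.pair hb)))).congr fun _ => rfl
  have hmN : ∀ {jf af bf : σ × (ℕ × ℕ) → ℕ}, CodeFP qctx natE jf → CodeFP qctx natE af → CodeFP qctx natE bf →
      CodeFP qctx natE (fun q => multNeN (Nf q.1) (posf q.1) (eqf q.1) (nef q.1) (jf q) (af q) (bf q)) :=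
    fun hj ha hb => (hMN.comp (hs.pair (hj.pair (ha.pair hb)))).congr fun _ => rfl
  have z : CodeFP qctx natE (fun _ => 0) := const _ 0
  have k0 : CodeFP qctx natE (fun _ => 0) := const _ 0
  have k6 : CodeFP qctx natE (fun _ => 6) := const _ 6
  have k7 : CodeFP qctx natE (fun _ => 7) := const _ 7
  -- decoded indices of `i` and `i'`
  have dI : CodeFP qctx natE (fun q => q.2.1 - Nf q.1) := (natSub.comp (hi.pair hNq)).congr fun _ => rfl
  have dI' : CodeFP qctx natE (fun q => q.2.2 - Nf q.1) := (natSub.comp (hi'.pair hNq)).congr fun _ => rfl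
  have jE : CodeFP qctx natE (fun q => (q.2.1 - Nf q.1) / 5) := (natDiv.comp (dI.pair (const _ 5))).congr fun _ => rfl
  have aE : CodeFP qctx natE (fun q => (q.2.1 - Nf q.1) % 5 + 1) :=
    (natAdd.comp ((natMod.comp (dI.pair (const _ 5))).pair (const _ 1))).congr fun _ => rfl
  have jE' : CodeFP qctx natE (fun q => (q.2.2 - Nf q.1) / 5) := (natDiv.comp (dI'.pair (const _ 5))).congr fun _ => rfl
  have aE' : CodeFP qctx natE (fun q => (q.2.2 - Nf q.1) % 5 + 1) :=
    (natAdd.comp ((natMod.comp (dI'.pair (const _ 5))).pair (const _ 1))).congr fun _ => rfl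
  have kI : CodeFP qctx natE (fun q => q.2.1 - Nf q.1 - (eqListN (Nf q.1) (eqf q.1)).length * 5) :=
    (natSub.comp (dI.pair hL5)).congr fun _ => rfl
  have kI' : CodeFP qctx natE (fun q => q.2.2 - Nf q.1 - (eqListN (Nf q.1) (eqf q.1)).length * 5) :=
    (natSub.comp (dI'.pair hL5)).congr fun _ => rfl
  have jN : CodeFP qctx natE (fun q => (q.2.1 - Nf q.1 - (eqListN (Nf q.1) (eqf q.1)).length * 5) / 6) :=
    (natDiv.comp (kI.pair (const _ 6))).congr fun _ => rfl
  have aN : CodeFP qctx natE (fun q => (q.2.1 - Nf q.1 - (eqListN (Nf q.1) (eqf q.1)).length * 5) % 6 + 1) :=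
    (natAdd.comp ((natMod.comp (kI.pair (const _ 6))).pair (const _ 1))).congr fun _ => rfl
  have jN' : CodeFP qctx natE (fun q => (q.2.2 - Nf q.1 - (eqListN (Nf q.1) (eqf q.1)).length * 5) / 6) :=
    (natDiv.comp (kI'.pair (const _ 6))).congr fun _ => rfl
  have aN' : CodeFP qctx natE (fun q => (q.2.2 - Nf q.1 - (eqListN (Nf q.1) (eqf q.1)).length * 5) % 6 + 1) :=
    (natAdd.comp ((natMod.comp (kI'.pair (const _ 6))).pair (const _ 1))).congr fun _ => rfl
  -- the edges looked up
  have eE' : CodeFP qctx (pairE natE natE) (fun q => (eqListN (Nf q.1) (eqf q.1)).getD ((q.2.2 - Nf q.1) / 5) (0, 0)) :=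
    (getPairFP.comp (hEq.pair jE')).congr fun _ => rfl
  have eN' : CodeFP qctx (pairE natE natE) (fun q => (neListN (Nf q.1) (nef q.1)).getD
      ((q.2.2 - Nf q.1 - (eqListN (Nf q.1) (eqf q.1)).length * 5) / 6) (0, 0)) :=
    (getPairFP.comp (hNe.pair jN')).congr fun _ => rfl
  have eE : CodeFP qctx (pairE natE natE) (fun q => (eqListN (Nf q.1) (eqf q.1)).getD ((q.2.1 - Nf q.1) / 5) (0, 0)) :=
    (getPairFP.comp (hEq.pair jE)).congr fun _ => rfl
  have eN : CodeFP qctx (pairE natE natE) (fun q => (neListN (Nf q.1) (nef q.1)).getD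
      ((q.2.1 - Nf q.1 - (eqListN (Nf q.1) (eqf q.1)).length * 5) / 6) (0, 0)) :=
    (getPairFP.comp (hNe.pair jN)).congr fun _ => rfl
  -- conditions
  have cC : CodeFP qctx bitE (fun q => decide (q.2.1 < card₂N (Nf q.1) (eqf q.1) (nef q.1)) &&
      decide (q.2.2 < card₂N (Nf q.1) (eqf q.1) (nef q.1))) :=
    ((natLt.comp (hi.pair hC)).and (natLt.comp (hi'.pair hC))).congr fun _ => rfl
  have cIN : CodeFP qctx bitE (fun q => decide (q.2.1 < Nf q.1)) := (natLt.comp (hi.pair hNq)).congr fun _ => rfl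
  have cI'N : CodeFP qctx bitE (fun q => decide (q.2.2 < Nf q.1)) := (natLt.comp (hi'.pair hNq)).congr fun _ => rfl
  have cIE : CodeFP qctx bitE (fun q => decide (q.2.1 - Nf q.1 < (eqListN (Nf q.1) (eqf q.1)).length * 5)) :=
    (natLt.comp (dI.pair hL5)).congr fun _ => rfl
  have cI'E : CodeFP qctx bitE (fun q => decide (q.2.2 - Nf q.1 < (eqListN (Nf q.1) (eqf q.1)).length * 5)) :=
    (natLt.comp (dI'.pair hL5)).congr fun _ => rfl
  have eqC : ∀ {f g : σ × (ℕ × ℕ) → ℕ}, CodeFP qctx natE f → CodeFP qctx natE g →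
      CodeFP qctx bitE (fun q => decide (f q = g q)) := fun hf hg => (natEq.comp (hf.pair hg)).congr fun _ => rfl
  -- branch: port `i`
  have bPE := (eqC hi (hlo eE')).ite (hmE jE' k0 aE') ((eqC hi (hhi eE')).ite (hmE jE' k6 aE') z)
  have bPN := (eqC hi (hlo eN')).ite (hmN jN' k0 aN') ((eqC hi (hhi eN')).ite (hmN jN' k7 aN') z)
  have bP := cI'N.ite z (cI'E.ite bPE bPN)
  -- branch: equality inner `i`
  have bEP := (eqC hi' (hlo eE)).ite (hmE jE aE k0) ((eqC hi' (hhi eE)).ite (hmE jE aE k6) z)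
  have bEE := (eqC jE' jE).ite (hmE jE aE aE') z
  have bE := cI'N.ite bEP (cI'E.ite bEE z)
  -- branch: inequality inner `i`
  have bNP := (eqC hi' (hlo eN)).ite (hmN jN aN k0) ((eqC hi' (hhi eN)).ite (hmN jN aN k7) z)
  have bNN := (eqC jN' jN).ite (hmN jN aN aN') z
  have bN := cI'N.ite bNP (cI'E.ite z bNN)
  exact (cC.ite (cIN.ite bP (cIE.ite bE bN)) z).congr fun q => by
    unfold multN
    simp only [decide_eq_true_eq, Bool.and_eq_true]


end FP

end RegN

/-! ## §2 The crossbar satisfies FILE D's hypotheses -/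

namespace Crossbar

open RelGridGraph

/-- Table fact: no local equality pair (nor its reverse) is a local inequality pair, and none is the
relation pair `(44, 26)` / `(26, 44)`. [cite: BlaserDorflerIkenmeyer2020, Lemma 28, Fig. 3colgridcrossing (arXiv; = CCC 2021 Lemma 8.7)] -/
private theorem localEq_clean : ∀ p ∈ localEq, p ∉ localNe ∧ (p.2, p.1) ∉ localNe ∧
    p ≠ (44, 26) ∧ p ≠ (26, 44) := by decide

/-- Table fact: the relation pair is not a local inequality pair. [cite: BlaserDorflerIkenmeyer2020, Lemma 28, Fig. 3colgridcrossing (arXiv; = CCC 2021 Lemma 8.7)] -/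
private theorem rel_not_localNe : ((44 : ℕ), (26 : ℕ)) ∉ localNe ∧ ((26 : ℕ), (44 : ℕ)) ∉ localNe := by decide

/-- What an `eqTest` edge looks like. [cite: BlaserDorflerIkenmeyer2020, Lemma 28, proof (arXiv; = CCC 2021 Lemma 8.7)] -/
private theorem eqTest_cases {V v w : ℕ} (h : eqTest V v w = true) :
    (v / 45 = w / 45 ∧ ((locOf v, locOf w) ∈ localEq ∨ (locOf v = 44 ∧ locOf w = 26 ∧ rowOf V v = colOf V v))) ∨
      (v / 45 ≠ w / 45 ∧ ((locOf v = 31 ∧ locOf w = 25) ∨ (locOf v = 38 ∧ locOf w = 32))) := by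
  unfold eqTest at h
  simp only [Bool.or_eq_true, Bool.and_eq_true, beq_iff_eq, decide_eq_true_eq] at h
  rcases h with ((⟨hb, hm⟩ | ⟨⟨⟨hb, hd⟩, h44⟩, h26⟩) | ⟨⟨⟨hc, hr⟩, h31⟩, h25⟩) | ⟨⟨⟨hr, hc⟩, h38⟩, h32⟩
  · exact Or.inl ⟨hb, Or.inl hm⟩
  · exact Or.inl ⟨hb, Or.inr ⟨h44, h26, hd⟩⟩
  · refine Or.inr ⟨fun hb => ?_, Or.inl ⟨h31, h25⟩⟩
    unfold rowOf at hr; rw [hb] at hr; omega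
  · refine Or.inr ⟨fun hb => ?_, Or.inr ⟨h38, h32⟩⟩
    unfold colOf at hc; rw [hb] at hc; omega

/-- What a `neTest` edge looks like. [cite: BlaserDorflerIkenmeyer2020, Lemma 28, proof (arXiv; = CCC 2021 Lemma 8.7)] -/
private theorem neTest_cases {V : ℕ} {adj : ℕ → ℕ → Bool} {v w : ℕ} (h : neTest V adj v w = true) :
    v / 45 = w / 45 ∧ ((locOf v, locOf w) ∈ localNe ∨ (locOf v = 44 ∧ locOf w = 26 ∧ rowOf V v ≠ colOf V v)) := by
  unfold neTest at h
  simp only [Bool.or_eq_true, Bool.and_eq_true, beq_iff_eq, decide_eq_true_eq, Bool.not_eq_true',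
    beq_eq_false_iff_ne, ne_eq] at h
  rcases h with ⟨hb, hm⟩ | ⟨⟨⟨⟨hb, hd⟩, -⟩, h44⟩, h26⟩
  · exact ⟨hb, Or.inl hm⟩
  · exact ⟨hb, Or.inr ⟨h44, h26, hd⟩⟩

/-- An `eqTest` edge and an `neTest` edge never coincide (either orientation). [cite: BlaserDorflerIkenmeyer2020, Lemma 28, proof (arXiv; = CCC 2021 Lemma 8.7)] -/
private theorem eqTest_neTest_false {V : ℕ} {adj : ℕ → ℕ → Bool} {v w : ℕ} (he : eqTest V v w = true)
    (hn : neTest V adj v w = true ∨ neTest V adj w v = true) : False := by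
  rcases eqTest_cases he with ⟨hb, hE⟩ | ⟨hb, -⟩
  · rcases hE with hm | ⟨h44, h26, hd⟩
    · obtain ⟨h1, h2, h3, h4⟩ := localEq_clean _ hm
      rcases hn with hn | hn
      · rcases (neTest_cases hn).2 with hm' | ⟨h44, h26, -⟩
        · exact h1 hm'
        · exact h3 (Prod.ext h44 h26)
      · rcases (neTest_cases hn).2 with hm' | ⟨h44, h26, -⟩
        · exact h2 hm'
        · exact h4 (Prod.ext h26 h44)
    · rcases hn with hn | hn
      · rcases (neTest_cases hn).2 with hm' | ⟨-, -, hd'⟩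
        · exact rel_not_localNe.1 (h44 ▸ h26 ▸ hm')
        · exact hd' hd
      · rcases (neTest_cases hn).2 with hm' | ⟨h44', -, -⟩
        · exact rel_not_localNe.2 (h44 ▸ h26 ▸ hm')
        · omega
  · rcases hn with hn | hn
    · exact hb (neTest_cases hn).1
    · exact hb (neTest_cases hn).1.symm

/-- **The crossbar's equality and inequality edge sets are disjoint** (FILE D's hypothesis
`EdgesSimple`: the local tables are disjoint and the relation stub is `=` or `≠`, never both).
[cite: BlaserDorflerIkenmeyer2020, Lemma 28, proof (arXiv; = CCC 2021 Lemma 8.7)] -/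
theorem eqB_neB_false {V : ℕ} {adj : ℕ → ℕ → Bool} {v w : ℕ} (he : eqB V v w = true)
    (hn : neB V adj v w = true) : False := by
  unfold eqB at he; unfold neB at hn
  rw [Bool.or_eq_true] at he hn
  rcases he with he | he
  · exact eqTest_neTest_false he hn
  · exact eqTest_neTest_false he (hn.symm)


/-- The crossbar has no isolated vertex (FILE D's hypothesis `NoIsolated`). [cite: BlaserDorflerIkenmeyer2020, Lemma 28, proof (arXiv; = CCC 2021 Lemma 8.7)] -/
theorem noIsolated (V : ℕ) (adj : ℕ → ℕ → Bool) : (crossbar V adj).NoIsolated := fun v => exists_adj adj v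

/-- The crossbar's edge labels are simple (FILE D's hypothesis `EdgesSimple`). [cite: BlaserDorflerIkenmeyer2020, Lemma 28, proof (arXiv; = CCC 2021 Lemma 8.7)] -/
theorem edgesSimple (V : ℕ) (adj : ℕ → ℕ → Bool) : (crossbar V adj).EdgesSimple :=
  fun _ _ h => eqB_neB_false h.1 h.2

/-- **The regularised crossbar has `≤ 13 · 45 V² ≤ 585 (V+1)²` vertices.** [cite: BlaserDorflerIkenmeyer2020, Lemma 29, proof ("O(|V(G)|) many vertices") with Lemma 28 ("|V(G)| = O(m²)") (arXiv; = CCC 2021 Lemmas 8.8, 8.7)] -/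
theorem card₂_le (V : ℕ) (adj : ℕ → ℕ → Bool) : (crossbar V adj).card₂ ≤ 585 * (V + 1) ^ 2 := by
  have h := (crossbar V adj).card₂_le (edgesSimple V adj)
  have hn : nV V ≤ 45 * (V + 1) ^ 2 := by unfold nV; nlinarith
  omega

end Crossbar

/-! ## §3 The kit: `Sec8.Regularisation` inhabited by Lemma 29 applied to the crossbar -/

namespace Sec8

open Literature.Computability.Complexity CodeFP GridLikeLayered RelGridGraph

/-- The crossbar's ℕ-level data on codes, with the unary budget `45 · U²` for `nV V = 45 V²`.
[cite: BlaserDorflerIkenmeyer2020, Lemma 28 (arXiv; = CCC 2021 Lemma 8.7)] [cite: AroraBarak2009, §1.3] -/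
theorem crossbarDataFP {σ : Type} {eσ : σ → List Bool} {Vf Uf : σ → ℕ} {adjf : σ → ℕ → ℕ → Bool}
    (hV : CodeFP eσ natE Vf) (hU : CodeFP eσ unE Uf) (hVU : ∀ s, Vf s ≤ Uf s)
    (hadj : CodeFP (pairE eσ (pairE natE natE)) bitE (fun q => adjf q.1 q.2.1 q.2.2)) :
    CodeFP eσ natE (fun s => Crossbar.nV (Vf s)) ∧ CodeFP eσ unE (fun s => 45 * Uf s ^ 2) ∧
      (∀ s, Crossbar.nV (Vf s) ≤ 45 * Uf s ^ 2) ∧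
      CodeFP (pairE eσ natE) (pairE natE natE) (fun q => Crossbar.posN (Vf q.1) q.2) ∧
      CodeFP (pairE eσ (pairE natE natE)) bitE (fun q => Crossbar.eqB (Vf q.1) q.2.1 q.2.2) ∧
      CodeFP (pairE eσ (pairE natE natE)) bitE (fun q => Crossbar.neB (Vf q.1) (adjf q.1) q.2.1 q.2.2) := by
  refine ⟨(natMul.comp ((const _ 45).pair (natMul.comp (hV.pair hV)))).congr fun _ => rfl,
    ((unMulConst 45).comp ((ulength unitE).comp ((unitsPow 2).comp hU))).congr fun _ => by simp,
    fun s => ?_, Crossbar.posNFP hV, Crossbar.eqBFP hV, Crossbar.neBFP hV hadj⟩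
  have := hVU s
  unfold Crossbar.nV
  nlinarith

/-- ★ **The regularisation kit of the crossbar** (Lemma 29 applied to Lemma 28's instance, with its
data on codes): the interface `Sec8.Regularisation` of `BDI20SemistandardHwvHardness` inhabited.
[cite: BlaserDorflerIkenmeyer2020, Lemma 29 with Lemmas 26, 28 (arXiv; = CCC 2021 Lemma 8.8 with Lemmas 8.5, 8.7)] [cite: AroraBarak2009, §1.3] -/
noncomputable def crossbarKit : Regularisation where
  size V adj := (Crossbar.crossbar V adj).card₂
  graph V adj := (Crossbar.crossbar V adj).regularise (Crossbar.noIsolated V adj) (Crossbar.edgesSimple V adj)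
  isRegular V adj := (Crossbar.crossbar V adj).regularise_isRegular _ _
  colourable_iff V adj := (Crossbar.crossbar V adj).regularise_isProper3_iff _ _
  C := 585
  size_le := Crossbar.card₂_le
  sizeFP := fun hV hU hVU hadj => by
    obtain ⟨hN, hU', hNU, hpos, heq, hne⟩ := crossbarDataFP hV hU hVU hadj
    exact (RegN.card₂FP hN hU' hNU heq hne).congr fun s => (card₂_crossbar _ _).symm
  posFP := fun {σ eσ Vf Uf adjf} hV hU hVU hadj => by
    obtain ⟨hN, hU', hNU, hpos, heq, hne⟩ := crossbarDataFP hV hU hVU hadj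
    exact (RegN.posNFP (Nf := fun s => Crossbar.nV (Vf s)) (posf := fun s => Crossbar.posN (Vf s))
      (eqf := fun s => Crossbar.eqB (Vf s)) (nef := fun s => Crossbar.neB (Vf s) (adjf s))
      hN hU' hNU hpos heq hne).congr fun q => (posOf_regularise_crossbar _ _ _ _ _).symm
  multFP := fun {σ eσ Vf Uf adjf} hV hU hVU hadj => by
    obtain ⟨hN, hU', hNU, hpos, heq, hne⟩ := crossbarDataFP hV hU hVU hadj
    exact (RegN.multNFP (Nf := fun s => Crossbar.nV (Vf s)) (posf := fun s => Crossbar.posN (Vf s))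
      (eqf := fun s => Crossbar.eqB (Vf s)) (nef := fun s => Crossbar.neB (Vf s) (adjf s))
      hN hU' hNU hpos heq hne).congr fun q => (multOf_regularise_crossbar _ _ _ _ _ _).symm

end Sec8

end BDI2020

/-! ## §4 The discharges -/

/-- ★★ **Discharge of `BDI2020_thm_8_9`** (BDI CCC 2021 Thm 8.9 = arXiv Thm 30, NP-hardness clause:
deciding `f_T̂(p) ≠ 0` for SEMISTANDARD tableaux of content `n × d`, `16 ∣ d`, `d ≥ 16`, `≤ m` rows,
`m ≥ 5`, at the fixed Waring-rank-`5` point is NP-hard). GRAPH 3-COLOURABILITY is NP-hard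
(`ThreeColouring.THREECOL_isNPHard`) and Karp-reduces to the language
(`Sec8.Regularisation.THREECOL_karpReducible` at `Sec8.crossbarKit`: graph ↦ crossbar (Lemma 28) ↦
`8`-regular grid-like layered multigraph (Lemma 29) ↦ the semistandard pair (Lemma 25) ↦ Thm 30's
tableau, all on codes). [cite: BlaserDorflerIkenmeyer2020, Thm 30 (arXiv; = CCC 2021 Thm 8.9)] -/
theorem BDI2020_thm_8_9_holds : BDI2020_thm_8_9 :=
  BDI2020.Sec8.Regularisation.thm_8_9_of_regularisation BDI2020.Sec8.crossbarKit

/-- ★★ **Discharge of `BDI2020_thm_8_9_eth`** (BDI CCC 2021 Thm 8.9 = arXiv Thm 30, ETH clause: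
"Assuming ETH, … can not be computed in time `2^{o(√n)}`"): under ETH, `3`-SAT with parameter `m` is
not in `SE`; the Karp map from `3`-SAT codes through the linear-size graph of
`BDI20BoundedDegreeSatGraph`, the crossbar and Lemma 29 has `√(#labels) = O(m)`, so a `2^{o(√n)}`
decider would put `3`-SAT[m] in `SE` (`BDI20ETH.not_hasSubexpDecider_of_codeFP`, IPZ SERF closure).
[cite: BlaserDorflerIkenmeyer2020, Thm 30 (arXiv; = CCC 2021 Thm 8.9)] [cite: ImpagliazzoPaturiZaneJCSS2001, §2.1, Cor. 2] -/
theorem BDI2020_thm_8_9_eth_holds : BDI2020_thm_8_9_eth :=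
  BDI2020.Sec8.Regularisation.thm_8_9_eth_of_regularisation BDI2020.Sec8.crossbarKit

end Literature.Computability.AlgebraicComplexity
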